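import Summits.Ventures.DiscreteObjects.Hadamard.Order83InvertingInvolution668
import Summits.Ventures.DiscreteObjects.Hadamard.Order167InvertingIndexFour668
import Summits.Ventures.DiscreteObjects.Hadamard.CyclicCoreDictionary668

/-!
# H(668): an involution inverting an element of order 83 with 12 fixed rows makes the eight cyclic cores SYMMETRIC —
# 8 symmetric `±1` sequences of length 83 with periodic autocorrelation sum `−4` (kernel dictionary; HANDOFF-H-g22 item 4)

Framing: lottery ticket; floor = certified bounds/negative ranges.

Cell pub-namedobj (venture DiscreteObjects), target (H), hadamard gen 22.  Gen 19 (`CyclicCoreDictionary668`,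
`hadamard668_pafFamily_83`): a signed automorphism `σ = (π, κ, d, e)` of an H(668) with `π^83 = κ^83 = 1`, `(π, κ) ≠ (1,1)`
(exactly `4 + 4` fixed rows/columns, `8 + 8` orbits) makes a free row of the re-signed matrix, read along the eight column
cycles, a family of EIGHT `±1` sequences `a_y : ℤ/83 → ℤ` with `Σ_y PAF_{a_y}(s) = −4` for every `s ≠ 0`.  Gen 22
(`Order83InvertingInvolution668`): an involution `ρ` INVERTING `σ` fixes `0, 4` or `12` rows, and `12` forces every orbit to be
preserved and every `σ`-fixed row to be fixed.  Here, in the case `f = 12`: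
* **`hadamard668_order83_symmetric_pafFamily`**: the eight sequences can be chosen SYMMETRIC: there are `T` (`|T| = 8`) and
  `a_y : ℤ/83 → {±1}` (`y ∈ T`) with **`a_y(−t) = a_y(t)`** and `Σ_{y∈T} PAF_{a_y}(s) = −4` (`s ≠ 0`).  [Base the free row at a
  `ρ`-fixed `σ`-moved row `x₀` (there are `8`); for a column representative `y` with `ρ y = κ^{c} y`, `ρ` acts on the re-signed
  matrix with signs constant along `σ`-orbits (`signs_const_of_normalizing`), so `H'(x₀, κ^{c−u} y) = η_y H'(x₀, κ^{u} y)`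
  with `η_y = 1` (put `u = 42c`, `2·42 ≡ 1`): the sequence `u ↦ H'(x₀, κ^u y)` is symmetric about `42c`, and its translate by
  `42c` (`PAF_translate`) is symmetric about `0`.]
So 'σ₈₃ with a 12-point inverting involution' is, at the sequence level, the SYMMETRIC-eight-circulant-core shape (the bordered
analogue of the symmetric 16-circulant array of gen 20 at 167).  One direction only (a full bordered-array converse is not
claimed).  STRUCTURE / DICTIONARY of a hypothetical object; no order excluded; H(668) untouched; HITS 0/4.  Ours; no `sorry`, no
definitions, default heartbeats.
-/

namespace Summit.Ventures.DiscreteObjects.Hadamard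

open Finset BigOperators Matrix

open Literature.Combinatorics.Designs.GoethalsSeidel (IsHadamardMatrix)
open Literature.Combinatorics.Designs.LegendrePairs (PAF IsPM translate PAF_translate)

variable {ι : Type*} [Fintype ι] [DecidableEq ι]

/-- `-41 = 42` in `ZMod 83` (`2 · 42 = 84 ≡ 1`) -/
lemma zmod83_neg41 : (-41 : ZMod 83) = 42 := by decide

section main
variable {H : Matrix ι ι ℤ} (hH : IsHadamardMatrix H) (hι : Fintype.card ι = 668)
  {π κ π' κ' : Equiv.Perm ι} {d e d' e' : ι → ℤ} (haut : IsSignedAut H π κ d e)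
  (hπ : π ^ 83 = 1) (hκ : κ ^ 83 = 1) (hne : π ≠ 1 ∨ κ ≠ 1)
  (haut' : IsSignedAut H π' κ' d' e') {μ : ℕ} (hnπ : π' * π = π ^ μ * π') (hnκ : κ' * κ = κ ^ μ * κ')
  (hμ : μ % 83 = 82) (h2 : π' ^ 2 = 1) (h2' : κ' ^ 2 = 1) (hne' : π' ≠ 1 ∨ κ' ≠ 1)
include hH hι haut hπ hκ hne haut' hnπ hnκ hμ h2 h2' hne'

/-- **Twelve fixed rows ⇒ eight SYMMETRIC cyclic cores.**  See the module docstring. -/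
theorem hadamard668_order83_symmetric_pafFamily (h12 : (univ.filter fun x => π' x = x).card = 12) :
    ∃ T : Finset ι, T.card = 8 ∧ ∃ a : {y // y ∈ T} → ZMod 83 → ℤ, (∀ y, IsPM (a y)) ∧ (∀ y t, a y (-t) = a y t) ∧
      ∀ s : ZMod 83, s ≠ 0 → ∑ y, PAF (a y) s = -4 := by
  have p83 : Nat.Prime 83 := by norm_num
  have h83 := hadamard668_fixedRows_83 hH hι π κ d e haut hπ hκ hne
  obtain ⟨-, -, himp⟩ := hadamard668_order83_inverting_involution hH hι haut hπ hκ hne haut' hnπ hnκ hμ h2 h2' hne'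
  obtain ⟨-, -, hcols, -⟩ := himp h12
  -- a ρ-fixed σ-moved row x₀
  obtain ⟨f₀, m, k, hk, -, hf, -, hmm⟩ := inverting83_count hπ hnπ hμ h2
  rw [h83.1] at hk
  obtain ⟨x₀, hx₀⟩ : (univ.filter fun x => π' x = x ∧ π x ≠ x).Nonempty := by
    rw [← Finset.card_pos, ← hmm]; omega
  obtain ⟨hx₀ρ, hx₀π⟩ := (Finset.mem_filter.mp hx₀).2
  have hfreeR : ∀ j, 0 < j → j < 83 → (π ^ j) x₀ ≠ x₀ :=
    free_of_fixed_prime_pow π p83 (by rw [hπ, Equiv.Perm.one_apply]) hx₀π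
  have hfreeC : ∀ y, κ y ≠ y → ∀ j, 0 < j → j < 83 → (κ ^ j) y ≠ y :=
    fun y hy => free_of_fixed_prime_pow κ p83 (by rw [hκ, Equiv.Perm.one_apply]) hy
  -- re-sign: σ is a permutation automorphism of H'
  obtain ⟨s, t, hs, ht, hH', hinv⟩ := exists_resign_of_odd hH haut (by decide : Odd 83) hπ hκ
  set H' : Matrix ι ι ℤ := Matrix.of fun i j => s i * t j * H i j with hH'def
  have hinv' : ∀ i j, H' (π i) (κ j) = H' i j := fun i j => by
    simp only [hH'def, Matrix.of_apply]; exact hinv i j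
  have hH'ne : ∀ i j, H' i j ≠ 0 := fun i j => pm_ne_zero (hH'.1 i j)
  -- ρ on H', signs constant along σ-orbits
  set dρ : ι → ℤ := fun i => s (π' i) * s i * d' i with hdρ
  set eρ : ι → ℤ := fun j => t (κ' j) * t j * e' j with heρ
  have hρ' : IsSignedAut H' π' κ' dρ eρ := signedAut_resign' hs ht haut'
  obtain ⟨-, heκ⟩ := signs_const_of_normalizing hH'ne hinv' (by decide : Odd 83) hπ hρ' hnπ hnκ x₀
  -- transversal of the moved columns
  set Y := univ.filter fun y => κ y ≠ y with hY
  have hstab : ∀ y ∈ Y, κ y ∈ Y := by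
    intro y hy
    rw [hY, Finset.mem_filter] at hy ⊢
    exact ⟨Finset.mem_univ _, fun h => hy.2 (κ.injective h)⟩
  have hper : ∀ y ∈ Y, (κ ^ 83) y = y := fun y _ => by rw [hκ, Equiv.Perm.one_apply]
  have hfreeY : ∀ y ∈ Y, ∀ j, 0 < j → j < 83 → (κ ^ j) y ≠ y := fun y hy => hfreeC y (Finset.mem_filter.mp hy).2
  obtain ⟨T, hTY, hTcard, hTsum⟩ := exists_free_transversal κ (by norm_num : 0 < 83) Y.card Y le_rfl hstab hper hfreeY
  have hYcard : Y.card = 664 := by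
    have hsplit := Finset.card_filter_add_card_filter_not (s := (univ : Finset ι)) (fun y => κ y = y)
    rw [h83.2, Finset.card_univ, hι] at hsplit
    have : (univ.filter fun y => ¬ κ y = y).card = 664 := by omega
    exact this
  rw [hYcard] at hTcard
  have hT8 : T.card = 8 := by omega
  -- the shift c_y of ρ on the orbit of y ∈ T
  have hc : ∀ y : {y // y ∈ T}, ∃ c : ℕ, κ' y.1 = (κ ^ c) y.1 := by
    intro y
    obtain ⟨c, -, hc⟩ := Finset.mem_image.mp (hcols y.1 (Finset.mem_filter.mp (hTY y.2)).2)
    exact ⟨c, hc.symm⟩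
  choose c hc using hc
  have hμ' : (μ : ZMod 83) = -1 := by
    rw [← ZMod.natCast_mod μ 83, hμ]; decide
  -- the reflection relation of the untranslated sequences
  have hrefl : ∀ (y : {y // y ∈ T}) (u : ZMod 83),
      H' x₀ ((κ ^ ((c y : ZMod 83) - u).val) y.1) = dρ x₀ * eρ y.1 * H' x₀ ((κ ^ u.val) y.1) := by
    intro y u
    have h1 := hρ'.2.2 x₀ ((κ ^ u.val) y.1)
    rw [hx₀ρ, norm_apply_pow hnκ u.val, hc y, ← Equiv.Perm.mul_apply, ← pow_add, heκ] at h1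
    have e1 : κ ^ (μ * u.val + c y) = κ ^ ((c y : ZMod 83) - u).val := by
      apply pow_eq_pow_of_natCast_eq_n hκ
      rw [ZMod.natCast_zmod_val]; push_cast; rw [ZMod.natCast_zmod_val, hμ']; ring
    rw [e1] at h1
    exact h1
  have hη : ∀ y : {y // y ∈ T}, dρ x₀ * eρ y.1 = 1 := by
    intro y
    have h1 := hrefl y (42 * (c y : ZMod 83))
    have e2 : (c y : ZMod 83) - 42 * (c y : ZMod 83) = 42 * (c y : ZMod 83) := by
      linear_combination (c y : ZMod 83) * zmod83_neg41
    rw [e2] at h1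
    have hne0 := hH'ne x₀ ((κ ^ (42 * (c y : ZMod 83)).val) y.1)
    have : (dρ x₀ * eρ y.1 - 1) * H' x₀ ((κ ^ (42 * (c y : ZMod 83)).val) y.1) = 0 := by linarith
    rcases mul_eq_zero.mp this with h9 | h9
    · linarith
    · exact (hne0 h9).elim
  -- the translated sequences
  refine ⟨T, hT8, fun y => translate (fun u => H' x₀ ((κ ^ u.val) y.1)) (42 * (c y : ZMod 83)), fun y u => hH'.1 _ _,
    fun y u => ?_, fun s₀ hs₀ => ?_⟩
  · -- symmetry
    show H' x₀ ((κ ^ (-u + 42 * (c y : ZMod 83)).val) y.1) = H' x₀ ((κ ^ (u + 42 * (c y : ZMod 83)).val) y.1)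
    have h1 := hrefl y (u + 42 * (c y : ZMod 83))
    rw [hη y, one_mul] at h1
    have e2 : (c y : ZMod 83) - (u + 42 * (c y : ZMod 83)) = -u + 42 * (c y : ZMod 83) := by
      linear_combination (c y : ZMod 83) * zmod83_neg41
    rw [e2] at h1
    exact h1
  · -- the autocorrelation sum: translation-invariance + the cyclic-core identity of gen 19
    have hsum : ∑ y : {y // y ∈ T}, PAF (translate (fun u => H' x₀ ((κ ^ u.val) y.1)) (42 * (c y : ZMod 83))) s₀ =
        ∑ y : {y // y ∈ T}, PAF (fun u => H' x₀ ((κ ^ u.val) y.1)) s₀ :=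
      Finset.sum_congr rfl fun y _ => PAF_translate _ _ _
    rw [hsum]
    obtain ⟨hs0, hsn⟩ := zmod_val_pos_of_ne_zero hs₀
    have hid := cyclicCore_paf_identity hH' hinv' hπ T hTsum hfreeR hs0 hsn
    rw [h83.2] at hid
    push_cast at hid
    rw [← hid, ← Finset.sum_coe_sort T]
    refine Finset.sum_congr rfl fun y _ => ?_
    unfold PAF
    have hterm : ∀ u : ZMod 83, H' x₀ ((κ ^ u.val) y.1) * H' x₀ ((κ ^ (u + s₀).val) y.1) =
        H' x₀ ((κ ^ u.val) y.1) * H' x₀ ((κ ^ (u.val + s₀.val)) y.1) := by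
      intro u
      rw [ZMod.val_add, pow_mod_of_pow_eq_one κ hκ]
    simp only [hterm]
    exact sum_zmod_val_eq_sum_range (fun j => H' x₀ ((κ ^ j) y.1) * H' x₀ ((κ ^ (j + s₀.val)) y.1))

end main

end Summit.Ventures.DiscreteObjects.Hadamard
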